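import Mathlib.NumberTheory.NumberField.FractionalIdeal
import Mathlib.RingTheory.FractionalIdeal.Norm
import Mathlib.RingTheory.DedekindDomain.Ideal.Lemmas
import Mathlib.LinearAlgebra.FreeModule.Finite.CardQuotient
import Literature.NumberTheory.NumberFields.DenominatorIdealFiniteHeight
import Literature.MeasureTheory.Group.LatticeSumSuperlattice
import Literature.NumberTheory.Automorphic.AutomorphicLFunctionProofs
import HarnessLib

/-!
# Regrouping a sum over a number field by denominator ideals: `Σ_ξ w(ξ)·N(𝔡_ξ)^{-(σ+1)} ≤ M · Σ_𝔡 N𝔡^{-σ}`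

Topic `NumberTheory/NumberFields`; namespace `Literature.NumberTheory.NumberFields` (sequel of ★ `DenominatorIdealFiniteHeight`).
KERNEL only: proved theorems, no definition, no named fact, no `sorry`.

Let `K` be a number field.  For a non-zero ideal `𝔡 ⊆ 𝓞_K` the inverse fractional ideal `𝔡⁻¹ = {ξ ∈ K : ξ𝔡 ⊆ 𝓞_K}` is
an additive subgroup of `K` containing `𝓞_K` with index `[𝔡⁻¹ : 𝓞_K] = N𝔡` (`relIndex_one_inv_coeIdeal`, from Mathlib's
`det_basisOfFractionalIdeal_eq_absNorm`).  Consequently (★ `LatticeSumSuperlattice`) a non-negative weight `w` whose sums over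
the translates `a + 𝓞_K` are uniformly `≤ M` has `Σ_{ξ ∈ 𝔡⁻¹} w(ξ) ≤ N𝔡 · M` (`sum_le_absNorm_mul_of_forall_mul_mem`).  Writing
`D(ξ) = Π_v max(1, |ξ|_v) = N(𝔡_ξ)` for the finite-place height of `(1, ξ)` (★ `DenominatorIdealFiniteHeight`: `𝔡_ξ` is an
ideal with `ξ𝔡_ξ ⊆ 𝓞_K`, i.e. `ξ ∈ 𝔡_ξ⁻¹`), regrouping the sum `Σ_{ξ ∈ K} w(ξ) D(ξ)^{-(σ+1)}` according to the value of `𝔡_ξ` gives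
the main theorem `summable_and_tsum_mul_finprod_rpow_neg_le`:

  `Σ_{ξ ∈ K} w(ξ) · D(ξ)^{-(σ+1)} ≤ M · Σ_{𝔡} N𝔡^{-σ} < ∞`   (`σ > 1`, ★ `summable_absNorm_rpow_neg`).

This is the number-field half ("count by denominators") of the convergence of the big-cell Fourier sum of a Siegel Eisenstein
series in Weil's range [Weil1965, n° 41, proof of Lemme 18 via Lemme 5 of n° 12; Garrett2018, §2.2–2.3]: the archimedean half —
the uniform bound `M` for sums over translates of the lattice `𝓞_K` — is ★ `LatticeSumDilationBound`.  Cell `hodgecm-mathlib`,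
FLOOR 0, E-2 desk, crux item H413, row SW2c-BOUND (E3′).  HC_CM is proved only modulo the 7 printed citations until rung 0
closes; this file is unconditional.

## References
* [Weil1965] A. Weil, *Sur la formule de Siegel dans la théorie des groupes classiques*, Acta Math. 113 (1965), n° 12 & 41.
* [Garrett2018] P. Garrett, *Modern Analysis of Automorphic Forms by Example* (2018), §2.2–2.3.
-/

set_option autoImplicit false

noncomputable section

open scoped NNReal nonZeroDivisors
open NumberField IsDedekindDomain Module

namespace Literature.NumberTheory.NumberFields

variable (K : Type*) [Field K] [NumberField K]

/-- Membership in the inverse of an integral ideal: `ξ ∈ 𝔡⁻¹ ↔ ξ·𝔡 ⊆ 𝓞_K`. [cite: Weil1965, n° 41] -/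
theorem mem_inv_coeIdeal_iff {𝔡 : Ideal (𝓞 K)} (h𝔡 : 𝔡 ≠ ⊥) {x : K} :
    x ∈ ((𝔡 : FractionalIdeal (𝓞 K)⁰ K)⁻¹ : FractionalIdeal (𝓞 K)⁰ K) ↔
      ∀ d ∈ 𝔡, ∃ c : 𝓞 K, x * (d : K) = c := by
  rw [FractionalIdeal.mem_inv_iff (FractionalIdeal.coeIdeal_ne_zero.mpr h𝔡)]
  constructor
  · intro h d hd
    obtain ⟨c, hc⟩ := (FractionalIdeal.mem_one_iff (𝓞 K)⁰).1
      (h (d : K) ((FractionalIdeal.mem_coeIdeal (𝓞 K)⁰).mpr ⟨d, hd, rfl⟩))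
    exact ⟨c, hc.symm⟩
  · intro h y hy
    obtain ⟨d, hd, rfl⟩ := (FractionalIdeal.mem_coeIdeal (𝓞 K)⁰).mp hy
    obtain ⟨c, hc⟩ := h d hd
    exact (FractionalIdeal.mem_one_iff (𝓞 K)⁰).2 ⟨c, hc.symm⟩

omit [NumberField K] in
/-- Membership in the unit fractional ideal: `ξ ∈ (1) ↔ ξ ∈ 𝓞_K`. [cite: Weil1965, n° 41] -/
theorem mem_one_fractionalIdeal_iff {x : K} :
    x ∈ (1 : FractionalIdeal (𝓞 K)⁰ K) ↔ ∃ c : 𝓞 K, (c : K) = x :=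
  FractionalIdeal.mem_one_iff (𝓞 K)⁰

/-- `𝓞_K ⊆ 𝔡⁻¹` for an integral ideal `𝔡 ≠ 0`. [cite: Weil1965, n° 41] -/
theorem one_le_inv_coeIdeal {𝔡 : Ideal (𝓞 K)} (h𝔡 : 𝔡 ≠ ⊥) :
    (1 : FractionalIdeal (𝓞 K)⁰ K) ≤ (𝔡 : FractionalIdeal (𝓞 K)⁰ K)⁻¹ := by
  rw [FractionalIdeal.le_inv_comm (one_ne_zero' (FractionalIdeal (𝓞 K)⁰ K))
    (FractionalIdeal.coeIdeal_ne_zero.mpr h𝔡), inv_one]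
  exact FractionalIdeal.coeIdeal_le_one

/-- **`[𝔡⁻¹ : 𝓞_K] = N𝔡`**: the index of `𝓞_K` in the inverse ideal `𝔡⁻¹ ⊆ K` is the absolute norm of `𝔡`.
[cite: Weil1965, n° 41] -/
theorem relIndex_one_inv_coeIdeal {𝔡 : Ideal (𝓞 K)} (h𝔡 : 𝔡 ≠ ⊥) :
    (((1 : FractionalIdeal (𝓞 K)⁰ K) : Submodule (𝓞 K) K).toAddSubgroup).relIndex
        ((((𝔡 : FractionalIdeal (𝓞 K)⁰ K)⁻¹ : FractionalIdeal (𝓞 K)⁰ K) : Submodule (𝓞 K) K).toAddSubgroup) =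
      Ideal.absNorm 𝔡 := by
  classical
  have h𝔡0 : (𝔡 : FractionalIdeal (𝓞 K)⁰ K) ≠ 0 := FractionalIdeal.coeIdeal_ne_zero.mpr h𝔡
  set I : (FractionalIdeal (𝓞 K)⁰ K)ˣ := (Units.mk0 _ h𝔡0)⁻¹ with hIdef
  have hI : (I : FractionalIdeal (𝓞 K)⁰ K) = (𝔡 : FractionalIdeal (𝓞 K)⁰ K)⁻¹ := by
    rw [hIdef, Units.val_inv_eq_inv_val, Units.val_mk0]
  let e : Free.ChooseBasisIndex ℤ (𝓞 K) ≃ Free.ChooseBasisIndex ℤ I := Fintype.equivOfCardEq (by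
    rw [← finrank_eq_card_chooseBasisIndex, ← finrank_eq_card_chooseBasisIndex, fractionalIdeal_rank])
  set b₁ : Basis (Free.ChooseBasisIndex ℤ (𝓞 K)) ℚ K := integralBasis K with hb₁
  set b₂ : Basis (Free.ChooseBasisIndex ℤ (𝓞 K)) ℚ K := (basisOfFractionalIdeal K I).reindex e.symm
    with hb₂
  have h₁ : (((1 : FractionalIdeal (𝓞 K)⁰ K) : Submodule (𝓞 K) K).toAddSubgroup) =
      AddSubgroup.closure (Set.range b₁) := by
    rw [← Submodule.span_int_eq_addSubgroupClosure]
    ext x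
    rw [Submodule.mem_toAddSubgroup, Submodule.mem_toAddSubgroup, FractionalIdeal.mem_coe, hb₁,
      mem_span_integralBasis, mem_one_fractionalIdeal_iff, RingHom.mem_range]
  have h₂ : ((((𝔡 : FractionalIdeal (𝓞 K)⁰ K)⁻¹ : FractionalIdeal (𝓞 K)⁰ K) : Submodule (𝓞 K) K).toAddSubgroup) =
      AddSubgroup.closure (Set.range b₂) := by
    rw [← Submodule.span_int_eq_addSubgroupClosure, hb₂, Basis.range_reindex]
    ext x
    rw [Submodule.mem_toAddSubgroup, Submodule.mem_toAddSubgroup, FractionalIdeal.mem_coe,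
      mem_span_basisOfFractionalIdeal, ← hI]
    rfl
  have H : (((1 : FractionalIdeal (𝓞 K)⁰ K) : Submodule (𝓞 K) K).toAddSubgroup) ≤
      ((((𝔡 : FractionalIdeal (𝓞 K)⁰ K)⁻¹ : FractionalIdeal (𝓞 K)⁰ K) : Submodule (𝓞 K) K).toAddSubgroup) :=
    (Submodule.toAddSubgroup_le _ _).mpr (FractionalIdeal.coe_le_coe.mpr (one_le_inv_coeIdeal K h𝔡))
  have key := AddSubgroup.relIndex_eq_abs_det _ _ H b₁ b₂ h₁ h₂
  have hdet : |b₁.det b₂| = ((Ideal.absNorm 𝔡 : ℚ))⁻¹ := by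
    rw [hb₁, hb₂, det_basisOfFractionalIdeal_eq_absNorm K I e, hI, map_inv₀,
      FractionalIdeal.coeIdeal_absNorm]
  have hmul : b₂.det b₁ * b₁.det b₂ = 1 := by rw [Basis.det_mul_det, Basis.det_self]
  have hN : (Ideal.absNorm 𝔡 : ℚ) ≠ 0 := by exact_mod_cast Ideal.absNorm_eq_zero_iff.not.mpr h𝔡
  have habs : |b₂.det b₁| = (Ideal.absNorm 𝔡 : ℚ) := by
    have h := congrArg abs hmul
    rw [abs_mul, hdet, abs_one, mul_inv_eq_one₀ hN] at h
    exact h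
  exact_mod_cast key.trans habs

/-- **`Σ_{ξ ∈ 𝔡⁻¹ ∩ T} w(ξ) ≤ N𝔡 · M`** for a non-negative weight `w` whose sums over all translates `a + 𝓞_K` are `≤ M`
(finite partial sums; ★ `LatticeSumSuperlattice`). [cite: Weil1965, n° 12, Lemme 5 (proof)] -/
theorem sum_le_absNorm_mul_of_forall_mul_mem {w : K → ℝ} (hw0 : ∀ x, 0 ≤ w x) {M : ℝ}
    (hM : ∀ a : K, Summable (fun x : 𝓞 K => w (a + x)) ∧ ∑' x : 𝓞 K, w (a + x) ≤ M)
    {𝔡 : Ideal (𝓞 K)} (h𝔡 : 𝔡 ≠ ⊥) (T : Finset K) (hT : ∀ ξ ∈ T, ∀ d ∈ 𝔡, ∃ c : 𝓞 K, ξ * (d : K) = c) :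
    ∑ ξ ∈ T, w ξ ≤ (Ideal.absNorm 𝔡 : ℝ) * M := by
  classical
  set L : AddSubgroup K := (((1 : FractionalIdeal (𝓞 K)⁰ K) : Submodule (𝓞 K) K).toAddSubgroup) with hL
  set L' : AddSubgroup K :=
    ((((𝔡 : FractionalIdeal (𝓞 K)⁰ K)⁻¹ : FractionalIdeal (𝓞 K)⁰ K) : Submodule (𝓞 K) K).toAddSubgroup) with hL'
  have hmemL : ∀ x : K, x ∈ L ↔ ∃ c : 𝓞 K, (c : K) = x := fun x => by
    rw [hL, Submodule.mem_toAddSubgroup, FractionalIdeal.mem_coe, mem_one_fractionalIdeal_iff]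
  -- `𝓞 K ≃ L`
  let eL : 𝓞 K ≃ L := Equiv.ofBijective (fun x => ⟨(x : K), (hmemL _).2 ⟨x, rfl⟩⟩) (by
    constructor
    · intro x y hxy
      exact RingOfIntegers.coe_injective (congrArg (fun z : L => (z : K)) hxy)
    · rintro ⟨y, hy⟩
      obtain ⟨c, hc⟩ := (hmemL y).1 hy
      exact ⟨c, Subtype.ext hc⟩)
  have hML : ∀ a : K, Summable (fun x : L => w (a + x)) ∧ ∑' x : L, w (a + x) ≤ M := by
    intro a
    have hs : Summable ((fun x : L => w (a + x)) ∘ eL) := (hM a).1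
    refine ⟨eL.summable_iff.mp hs, ?_⟩
    rw [← eL.tsum_eq]
    exact (hM a).2
  have hind : L.relIndex L' = Ideal.absNorm 𝔡 := relIndex_one_inv_coeIdeal K h𝔡
  have hind0 : L.relIndex L' ≠ 0 := by
    rw [hind]
    exact Ideal.absNorm_eq_zero_iff.not.mpr h𝔡
  have hmemT : ∀ ξ ∈ T, ξ ∈ L' := fun ξ hξ => by
    rw [hL', Submodule.mem_toAddSubgroup, FractionalIdeal.mem_coe]
    exact (mem_inv_coeIdeal_iff K h𝔡).2 (hT ξ hξ)
  have h := Literature.MeasureTheory.Group.sum_le_relIndex_mul hind0 hw0 hML (T.subtype (· ∈ L'))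
  rw [Finset.sum_subtype_of_mem (fun ξ : K => w ξ) hmemT, hind] at h
  exact h

/-- **Regrouping by denominators.**  Let `w ≥ 0` on `K` have all its sums over translates `a + 𝓞_K` bounded by `M`, and let
`σ > 1`.  Then, with `D(ξ) = Π_v max(1, |ξ|_v)` the finite-place height of `(1, ξ)`,
`Σ_{ξ ∈ K} w(ξ) · D(ξ)^{-(σ+1)} ≤ M · Σ_𝔡 N𝔡^{-σ}` (and the left side is summable).
[cite: Weil1965, n° 41 (proof of Lemme 18)] -/
theorem summable_and_tsum_mul_finprod_rpow_neg_le {w : K → ℝ} (hw0 : ∀ x, 0 ≤ w x) {M : ℝ}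
    (hM : ∀ a : K, Summable (fun x : 𝓞 K => w (a + x)) ∧ ∑' x : 𝓞 K, w (a + x) ≤ M)
    {σ : ℝ} (hσ : 1 < σ) :
    Summable (fun ξ : K => w ξ *
        (((∏ᶠ v : HeightOneSpectrum (𝓞 K), max 1 ‖(ξ : v.adicCompletion K)‖₊ : ℝ≥0) : ℝ) ^ (-(σ + 1)))) ∧
      ∑' ξ : K, w ξ *
          (((∏ᶠ v : HeightOneSpectrum (𝓞 K), max 1 ‖(ξ : v.adicCompletion K)‖₊ : ℝ≥0) : ℝ) ^ (-(σ + 1))) ≤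
        M * ∑' 𝔡 : Ideal (𝓞 K), (Ideal.absNorm 𝔡 : ℝ) ^ (-σ) := by
  classical
  choose den hden0 hdenmem hdenN using
    fun ξ : K => exists_ideal_mul_mem_and_absNorm_eq_finprod_max_one_nnnorm (K := K) ξ
  set D : K → ℝ := fun ξ =>
    (((∏ᶠ v : HeightOneSpectrum (𝓞 K), max 1 ‖(ξ : v.adicCompletion K)‖₊ : ℝ≥0) : ℝ)) with hD
  have hDξ : ∀ ξ, D ξ = (Ideal.absNorm (den ξ) : ℝ) := fun ξ => by
    simp only [hD, ← hdenN ξ, NNReal.coe_natCast]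
  have hM0 : 0 ≤ M := le_trans (tsum_nonneg fun x => hw0 _) (by simpa using (hM 0).2)
  have hsumI := Literature.NumberTheory.Automorphic.summable_absNorm_rpow_neg (K := K) hσ
  have hInn : ∀ 𝔡 : Ideal (𝓞 K), 0 ≤ (Ideal.absNorm 𝔡 : ℝ) ^ (-σ) := fun 𝔡 =>
    Real.rpow_nonneg (Nat.cast_nonneg _) _
  have hbound : ∀ S : Finset K, ∑ ξ ∈ S, w ξ * D ξ ^ (-(σ + 1)) ≤
      M * ∑' 𝔡 : Ideal (𝓞 K), (Ideal.absNorm 𝔡 : ℝ) ^ (-σ) := by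
    intro S
    rw [← Finset.sum_fiberwise_of_maps_to (g := den) (fun ξ hξ => Finset.mem_image_of_mem den hξ)]
    calc ∑ 𝔡 ∈ S.image den, ∑ ξ ∈ S.filter (fun ξ => den ξ = 𝔡), w ξ * D ξ ^ (-(σ + 1))
        = ∑ 𝔡 ∈ S.image den, (Ideal.absNorm 𝔡 : ℝ) ^ (-(σ + 1)) *
            ∑ ξ ∈ S.filter (fun ξ => den ξ = 𝔡), w ξ := by
          refine Finset.sum_congr rfl fun 𝔡 _ => ?_
          rw [Finset.mul_sum]
          refine Finset.sum_congr rfl fun ξ hξ => ?_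
          rw [hDξ ξ, (Finset.mem_filter.1 hξ).2, mul_comm]
      _ ≤ ∑ 𝔡 ∈ S.image den, (Ideal.absNorm 𝔡 : ℝ) ^ (-(σ + 1)) * ((Ideal.absNorm 𝔡 : ℝ) * M) := by
          refine Finset.sum_le_sum fun 𝔡 h𝔡 => ?_
          refine mul_le_mul_of_nonneg_left ?_ (Real.rpow_nonneg (Nat.cast_nonneg _) _)
          obtain ⟨ξ₀, _, rfl⟩ := Finset.mem_image.1 h𝔡
          exact sum_le_absNorm_mul_of_forall_mul_mem K hw0 hM (hden0 ξ₀) _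
            (fun ξ hξ => (Finset.mem_filter.1 hξ).2 ▸ hdenmem ξ)
      _ = M * ∑ 𝔡 ∈ S.image den, (Ideal.absNorm 𝔡 : ℝ) ^ (-σ) := by
          rw [Finset.mul_sum]
          refine Finset.sum_congr rfl fun 𝔡 h𝔡 => ?_
          obtain ⟨ξ₀, _, rfl⟩ := Finset.mem_image.1 h𝔡
          have hN : (Ideal.absNorm (den ξ₀) : ℝ) ≠ 0 := by
            exact_mod_cast Ideal.absNorm_eq_zero_iff.not.mpr (hden0 ξ₀)
          rw [show -σ = -(σ + 1) + 1 by ring, Real.rpow_add_one hN]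
          ring
      _ ≤ M * ∑' 𝔡 : Ideal (𝓞 K), (Ideal.absNorm 𝔡 : ℝ) ^ (-σ) :=
          mul_le_mul_of_nonneg_left (hsumI.sum_le_tsum _ (fun 𝔡 _ => hInn 𝔡)) hM0
  have hnn : ∀ ξ, 0 ≤ w ξ * D ξ ^ (-(σ + 1)) := fun ξ =>
    mul_nonneg (hw0 ξ) (Real.rpow_nonneg (NNReal.coe_nonneg _) _)
  have hS : Summable (fun ξ : K => w ξ * D ξ ^ (-(σ + 1))) := summable_of_sum_le hnn hbound
  exact ⟨hS, hS.tsum_le_of_sum_le hbound⟩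

end Literature.NumberTheory.NumberFields
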